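import Summits.QuantumFields.GaugeBoot.Rows.GLYZc1D3Canon
import Summits.QuantumFields.GaugeBoot.Rows.GLYZc1D3EqsC
import HarnessLib

/-!
# Gauge-boot: relaxation soundness for the certified glyz-c1-rp-3D problems (rows C3–C14)

Cell `pub-gaugeboot` (HOME `run/shared/lean/pub/pub-gaugeboot/`), seat lean1 (binding layer). Assembles
`GLYZc1D3Eqs{A,B,C}` (𝓔: the 103 equality rows), `GLYZc1D3Blocks`/`GLYZc1D3Canon` (𝓟: the three positivity blocks,
entries identified with the problem variables by kernel-checked class tables) and the a-priori bounds into ONE statement.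

HONEST FRAMING (page 1 of every file of this cell): certified bounds on lattice expectations at STATED coupling,
gauge group, dimension and torus size; NOT a mass gap, NOT a continuum limit, NOT a string tension, NOT large `N`.
The venture is explicitly NOT Yang–Mills-summit-bearing (barriers `FixedCouplingUltralocality`,
`PerturbativeInvisibility`).

## Content

* `Feasible β z`: a word-indexed real assignment `z` (value of the variable labelled `w`) satisfies every constraint of
  the certsdp problem `glyzc1rp_D3_b<β>_{upper,lower}.problem1.json` — unit variable, `|z| ≤ 1` on the 435 labelled
  variables, the 103 rows of `E` at coupling `β`, and positive semi-definiteness of the `H` (85 × 85), `site1`, `link1`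
  (46 × 46) blocks whose entries are the variables `label (N1c1D3.cls<k> i j)` (lean3's shared class tables). The
  correspondence of `label`/`E`/`cls<k>` with the JSON files of record is entry-by-entry (generators
  `work/glyz/gen_eqs.py`, `gen_tables.py`, exact); the upper and lower problems at each `β` have identical constraints.
* **`feasible`** (RELAXATION SOUNDNESS): for every real `β_std ≥ 0` and every even torus `(ℤ/L)³` with `L ≥ 4`, the
  Wilson–Haar loop expectations `w ↦ ⟨W_0(w)⟩_{β}` are `Feasible β`. Hence any valid bound on the objective over the
  feasible set — which is what the two exact-rational certificate readers establish from the dual certificate (weak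
  duality; reader-certified, NOT kernel-checked, FANOUT-PLAN A56 (2)) — is a bound on the torus plaquette expectation:
  `plaquetteExpectation_le_of_upperClaim`, `le_plaquetteExpectation_of_lowerClaim`, `t1_of_claims` (shape (A), `L₀ = 4`).
  `UpperClaim β b` / `LowerClaim β a` are HYPOTHESES naming exactly the readers' statement; no certificate is asserted here.
-/

noncomputable section

open Literature.MathematicalPhysics.QuantumFieldTheory

namespace Summit.QuantumFields.GaugeBoot

namespace GLYZc1D3

/-- A row of `E` evaluated on a word-indexed assignment `z` at coupling `β`: `∑ (c0 + c1·β/8) · z w`. -/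
def rowEval (β : ℝ) (z : Word 3 → ℝ) (r : List (Word 3 × ℚ × ℚ)) : ℝ :=
  (r.map fun t => (((t.2.1 : ℚ) : ℝ) + ((t.2.2 : ℚ) : ℝ) * (β / 8)) * z t.1).sum

/-- The plaquette word `abAB` (problem column `1`, the objective variable). -/
abbrev plaq : Word 3 := [.fwd 0, .fwd 1, .bwd 0, .bwd 1]

/-- **Feasibility for the certified glyz-c1-rp-3D problem at coupling `β`** (both senses; the constraints of
`certs/SU2-D3/glyz-c1/glyzc1rp_D3_b<β>_{upper,lower}.problem1.json` over word-indexed variables). -/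
structure Feasible (β : ℝ) (z : Word 3 → ℝ) : Prop where
  /-- the unit variable (column `0`, empty word) -/
  unit : z [] = 1
  /-- a-priori bounds `|y_v| ≤ 1` on all 435 variables -/
  abs_le : ∀ v : Fin 435, |z (label v)| ≤ 1
  /-- the 103 equality rows (𝓔) -/
  eqs : ∀ j < E.length, rowEval β z (E.getD j []) = 0
  /-- the Hermitian block `H/unreduced` is positive semi-definite -/
  gram : ∀ c : Fin 85 → ℝ, 0 ≤ ∑ i, ∑ j, c i * c j * z (label (Certificates.N1c1D3.cls0 i j))
  /-- the site-reflection block `site1/unreduced` is positive semi-definite -/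
  site : ∀ c : Fin 46 → ℝ, 0 ≤ ∑ i, ∑ j, c i * c j * z (label (Certificates.N1c1D3.cls1 i j))
  /-- the link-reflection block `link1/unreduced` is positive semi-definite -/
  link : ∀ c : Fin 46 → ℝ, 0 ≤ ∑ i, ∑ j, c i * c j * z (label (Certificates.N1c1D3.cls2 i j))

variable (β : ℝ) (L : ℕ) [NeZero L]

/-- `rowEval` on the torus expectations is `rowSum`. -/
theorem rowEval_W (r : List (Word 3 × ℚ × ℚ)) : rowEval β (Rung0D3.W β L) r = rowSum β L r := rfl

/-- `⟨W_0(∅)⟩ = 1`. -/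
theorem W_nil : Rung0D3.W β L [] = 1 := by
  have h := Rung0D3.y_zero β L
  simpa [Rung0D3.y, Rung0D3.rep] using h

/-- **Relaxation soundness.** On every even torus `(ℤ/L)³` with `L ≥ 4` and at every standard coupling `β_std ≥ 0`,
the Wilson–Haar loop expectations `w ↦ ⟨W_0(w)⟩_β` of `SU(2)` lattice gauge theory satisfy every constraint of the
certified glyz-c1-rp-3D problem at `β`. -/
theorem feasible (hβ : 0 ≤ β) (hL : Even L) (h4 : 4 ≤ L) : Feasible β (Rung0D3.W β L) where
  unit := W_nil β L
  abs_le v := abs_wilsonExpectation_wordLoop_le_one (suRep 2) (continuous_suRep 2) _ 0 (label v)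
  eqs j hj := by rw [rowEval_W]; exact E_holds β L h4 j hj
  gram c := H_nonneg_label β L c
  site c := site_nonneg_label β L hL c
  link c := link_nonneg_label β L hL h4 hβ c

/-- The readers' statement for an UPPER certificate at `β`: every feasible assignment has plaquette value `≤ b`
(weak duality from the exact dual certificate; verified by the two certsdp readers, NOT by the kernel). -/
def UpperClaim (β b : ℝ) : Prop := ∀ z : Word 3 → ℝ, Feasible β z → z plaq ≤ b

/-- The readers' statement for a LOWER certificate at `β`. -/
def LowerClaim (β a : ℝ) : Prop := ∀ z : Word 3 → ℝ, Feasible β z → a ≤ z plaq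

/-- The torus plaquette expectation is the objective variable. -/
theorem plaquetteExpectation_eq_W : plaquetteExpectation 2 3 L β = Rung0D3.W β L plaq := by
  unfold plaquetteExpectation Rung0D3.W
  rw [wilsonExpectation_meanPlaquette_eq_plaquetteTrace (suRep 2) (continuous_suRep 2) _ (0 : Site 3 L)
    (show (0 : Fin 3) ≠ 1 by decide), ← wordLoop_plaquette]
  rfl

/-- **Upper end, named-hypothesis form**: if the readers' upper claim holds at `β_std ≥ 0` with bound `b`, then
`⟨ū_P⟩ ≤ b` on every even torus `(ℤ/L)³`, `L ≥ 4`. -/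
theorem plaquetteExpectation_le_of_upperClaim {b : ℝ} (h : UpperClaim β b) (hβ : 0 ≤ β) (hL : Even L) (h4 : 4 ≤ L) :
    plaquetteExpectation 2 3 L β ≤ b := by
  rw [plaquetteExpectation_eq_W]
  exact h _ (feasible β L hβ hL h4)

/-- **Lower end, named-hypothesis form.** -/
theorem le_plaquetteExpectation_of_lowerClaim {a : ℝ} (h : LowerClaim β a) (hβ : 0 ≤ β) (hL : Even L) (h4 : 4 ≤ L) :
    a ≤ plaquetteExpectation 2 3 L β := by
  rw [plaquetteExpectation_eq_W]
  exact h _ (feasible β L hβ hL h4)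

/-- **Shape (A) window from the two readers' claims** (`T1 = PlaquetteWindow 2 3`, threshold `L₀ = 4`): the form in which
a CERTIFIED row C3–C14 enters the Lean layer — `𝓔 ∧ 𝓟 ∧` bounds kernel-checked for the torus state, the certificate
half as the stated hypothesis. -/
theorem t1_of_claims {β a b : ℝ} (hβ : 0 ≤ β) (hu : UpperClaim β b) (hl : LowerClaim β a) : T1 4 β a b :=
  fun L _ hL h4 => ⟨le_plaquetteExpectation_of_lowerClaim β L hl hβ hL h4,
    plaquetteExpectation_le_of_upperClaim β L hu hβ hL h4⟩

end GLYZc1D3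

end Summit.QuantumFields.GaugeBoot

end
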